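import Literature.Topology.FourManifolds.HCobordismWallFilling
import Literature.Topology.FourManifolds.StabilisationCobordism
import Literature.Topology.FourManifolds.HomotopySpheresBP
import Literature.AlgebraicTopology.SingularHomology.ExcisionMayerVietorisProofs
import Literature.AlgebraicTopology.SingularHomology.ClosedBallSphereHomology
import HarnessLib

/-!
# The standard filling of `𝕊⁴ # k(S² × S²)` and its dying classes

Topic `Literature/Topology/FourManifolds`; fact seat of
`Literature.Topology.FourManifolds.isHCobordant_of_equivalent_intersectionForm` (**C. T. C. Wall,
*On simply-connected 4-manifolds*, J. London Math. Soc. 39 (1964) 141–149, Thm. 2**), step F-B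
of WALL'S TRICK (`HCobordismWallFilling.lean`): the filling that replaces Wall's handlebody
`V ∈ ℋ(5, k, 2)` of Thm. 1 + Lemma 2.

For a `k`-fold stabilisation `P` of the standard sphere `𝕊⁴` (`IsStabilization k (𝕊 4) P`,
i.e. `P ≅ 𝕊⁴ # k(S² × S²)` built one summand at a time) the tree's
`exists_stabilisationCobordism` gives the cobordism `E : 𝕊⁴ ∼ P` of the `k` trivial 1-surgeries
(Kirby 1989, Ch. X p. 55: `M × I ∪ 2-handles`) WITH its lattice data: an identification
`Θ : H²(𝕊⁴)/T ⊕ (ℤ²)ᵏ ≅ H²(P)/T` carrying the form to `Q_{𝕊⁴} ⊥ k·H`, and the law "a class of `P`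
orthogonal to all `βⱼ = Θ(0, eⱼ ⊗ (1, 0))` comes from `𝕊⁴` in `E`".  Attaching `E` to the closed
ball `𝔻⁵` (`NullCobordism.closedBall 4`, Milnor's Thm. 1.4 `exists_cobordismAttachment_holds`)
gives **the standard filling `V = 𝔻⁵ ∪_{𝕊⁴} E` of `P`** (a boundary connected sum of `k` copies
of `S² × D³`, though that description is not needed): compact, simply connected (van Kampen),
with `H₂(P) → H₂(V)` onto (Mayer–Vietoris) and every class orthogonal to the `βⱼ` dying in `V`
(`H₂(𝕊⁴) = 0`).  With `H²(𝕊⁴)/T = 0` the form of `P` is `k·H` on the nose of `Θ`.  This is exactly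
the input of `isHCobordant_of_wallFilling_of_annihilator` about the filling (detector
`π₀ = (⟨βⱼ, ·⟩)ⱼ`, `L = span {βⱼ}`), the mover and the h-cobordism being supplied in the sequel.

* `exists_isStabilization_sphereFour` — `𝕊⁴` has `k`-fold stabilisations (closed smooth simply
  connected 4-manifolds), by `StdChart.isConnectedSum_top`.
* `freeCohomology_sphereFour_two_eq_zero` — `H²(𝕊⁴; ℤ)/T = 0` (Kronecker duality with
  `H₂(𝕊⁴) = 0`).
* `exists_standardFilling_of_isStabilization_sphereFour` — the filling with its three laws.

Everything is proved; no named fact and no definition is introduced.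

## References

* C. T. C. Wall, *On simply-connected 4-manifolds*, J. London Math. Soc. 39 (1964) 141–149,
  §2 pp. 144–146. [WallJLMS1964]
* R. C. Kirby, *The topology of 4-manifolds*, LNM 1374 (1989), Ch. X, proof of Thm. 1
  (pp. 55–56). [Kirby1989]
* J. Milnor, *Lectures on the h-cobordism theorem*, Princeton (1965), §1 Thm. 1.4.
  [MilnorHCobordism1965]
* A. Hatcher, *Algebraic Topology*, CUP (2002), §2.2 p. 149, Prop. 1.14. [HatcherAT2002]
-/

open scoped Manifold ContDiff Topology
open Set Function Module CategoryTheory CategoryTheory.Limits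
open Literature.AlgebraicTopology.SingularHomology Literature.AlgebraicTopology.Homotopy

noncomputable section

namespace Literature.Topology.FourManifolds

/-- Local notation: `𝔼 n` is the model Euclidean space `EuclideanSpace ℝ (Fin n)`. -/
local notation "𝔼 " n:arg => EuclideanSpace ℝ (Fin n)

/-- Local notation: `𝕊 n` is the unit sphere in `EuclideanSpace ℝ (Fin (n + 1))`. -/
local notation "𝕊 " n:arg => (Metric.sphere (0 : EuclideanSpace ℝ (Fin (n + 1))) 1)

/-- Local notation: `Q⟦μ⟧` is the intersection form on `H²(·; ℤ)/T`. -/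
local notation "Q⟦" μ "⟧" =>
  Literature.AlgebraicTopology.SingularHomology.intersectionForm two_add_two_eq_four μ

/-! ### Stabilisations of the 4-sphere exist -/

/-- **`𝕊⁴` has a `k`-fold stabilisation `𝕊⁴ # k(S² × S²)` which is a closed smooth simply
connected 4-manifold** (induction on `k`: the top end of the trace on a standard chart,
`StdChart.isConnectedSum_top`, `IsStabilization.succ`). [cite: Kirby1989, Ch. X, proof of Thm. 1, p. 55] -/
theorem exists_isStabilization_sphereFour (k : ℕ) :
    ∃ (P : Type) (_ : TopologicalSpace P) (_ : T2Space P) (_ : SecondCountableTopology P)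
      (_ : ChartedSpace (𝔼 4) P) (_ : CompactSpace P) (_ : IsManifold (𝓡 4) ∞ P)
      (_ : SimplyConnectedSpace P), IsStabilization k (𝕊 4) P := by
  haveI : SimplyConnectedSpace (𝕊 4) := simplyConnectedSpace_euclideanSphere (n := 4) (by norm_num)
  induction k with
  | zero =>
    exact ⟨𝕊 4, inferInstance, inferInstance, inferInstance, inferInstance, inferInstance,
      inferInstance, inferInstance, (isStabilization_zero_iff (𝕊 4) (𝕊 4)).2 ⟨Diffeomorph.refl (𝓡 4) (𝕊 4) ∞⟩⟩
  | succ k ih =>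
    obtain ⟨P, _, _, _, _, _, _, _, hP⟩ := ih
    obtain ⟨C, -, -⟩ := StdChart.exists_mem_source (Classical.arbitrary P)
    have hP' : IsStabilization (k + 1) (𝕊 4) C.Top := hP.succ C.isConnectedSum_top
    obtain ⟨hsc, hc, hsnd, -⟩ := exists_stabilisationCobordism (k + 1) (𝕊 4) C.Top hP'
    exact ⟨C.Top, inferInstance, inferInstance, hsnd, inferInstance, hc, inferInstance, hsc, hP'⟩

/-! ### `H²(𝕊⁴)/T = 0` -/

/-- **`H²(𝕊⁴; ℤ)/T = 0`**: the Kronecker map `H²(𝕊⁴)/T → Hom(H₂(𝕊⁴), ℤ)` is one-to-one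
(`freeKroneckerPairing_two_bijective`, `𝕊⁴` simply connected) and `H₂(𝕊⁴; ℤ) = 0`.
[cite: HatcherAT2002, Prop. 1.14, Cor. 2.14, Thm. 3.2] -/
theorem freeCohomology_sphereFour_two_eq_zero (z : freeCohomology ℤ (𝕊 4) 2) : z = 0 := by
  haveI : SimplyConnectedSpace (𝕊 4) := simplyConnectedSpace_euclideanSphere (n := 4) (by norm_num)
  have h2 : IsZero (singularHomology ℤ ℤ (𝕊 4) 2) :=
    isZero_singularHomology_sphere_holds ℤ ℤ (n := 4) (k := 2) (by omega) (by omega)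
  haveI := ModuleCat.subsingleton_of_isZero h2
  apply (freeKroneckerPairing_two_bijective (X := 𝕊 4)).1
  ext y
  rw [Subsingleton.elim y 0, map_zero, map_zero]

/-! ### The standard filling -/

/-- **The standard filling `V = 𝔻⁵ ∪_{𝕊⁴} E` of a `k`-fold stabilisation `P` of `𝕊⁴`, with its
laws.**  For `P` with `IsStabilization k (𝕊 4) P` and a `ℤ`-orientation `μP` of `P` there are: a
compact simply connected smooth 5-manifold with boundary `V`, a smooth embedding `ι : P → V` onto
`∂V`, and an additive identification `Θ : H²(𝕊⁴)/T ⊕ (ℤ²)ᵏ ≅ H²(P)/T`, such that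
(i) `ι_* : H₂(P) → H₂(V)` is onto; (ii) every `y ∈ H₂(P)` with `⟨βⱼ, y⟩ = 0` for all `j`
(`βⱼ = Θ(0, eⱼ ⊗ (1,0))`) has `ι_* y = 0`; (iii) `Q⟦μP⟧ (Θ x) (Θ y) = Σⱼ H(x₂ⱼ, y₂ⱼ)`.
Construction: `E : 𝕊⁴ ∼ P` with its lattice data (`exists_stabilisationCobordism`, Kirby p. 55),
attached to `𝔻⁵` (`NullCobordism.closedBall 4`, `exists_cobordismAttachment_holds`, Milnor
Thm. 1.4); `V` is simply connected by van Kampen (`CobordismAttachment.simplyConnectedSpace`,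
`𝔻⁵` contractible); (i) Mayer–Vietoris (`CobordismAttachment.epi_map_jX_of_epi`: `H₁(𝕊⁴) = 0`,
`H₂(𝔻⁵) = 0`) composed with `H₂(P) → H₂(E)` onto; (ii) such `y` come from `H₂(𝕊⁴) = 0` in `E`;
(iii) the form law of the data with `H²(𝕊⁴)/T = 0`.
[cite: WallJLMS1964, §2 pp. 144–146] [cite: Kirby1989, Ch. X, proof of Thm. 1, pp. 55–56]
[cite: MilnorHCobordism1965, §1, Thm. 1.4] [cite: HatcherAT2002, §2.2 p. 149] -/
theorem exists_standardFilling_of_isStabilization_sphereFour (k : ℕ) (P : Type)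
    [TopologicalSpace P] [T2Space P] [SecondCountableTopology P] [ChartedSpace (𝔼 4) P]
    [CompactSpace P] [IsManifold (𝓡 4) ∞ P] (hP : IsStabilization k (𝕊 4) P)
    (μP : HomologicalOrientation ℤ P 4) :
    ∃ (V : Type) (_ : TopologicalSpace V) (_ : T2Space V) (_ : SecondCountableTopology V)
      (_ : ChartedSpace (EuclideanHalfSpace (4 + 1)) V) (_ : IsManifold (𝓡∂ (4 + 1)) ∞ V)
      (_ : CompactSpace V) (_ : SimplyConnectedSpace V)
      (ι : P → V) (hι : Manifold.IsSmoothEmbedding (𝓡 4) (𝓡∂ (4 + 1)) ∞ ι)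
      (_ : range ι = (𝓡∂ (4 + 1)).boundary V)
      (Θ : (↥(freeCohomology ℤ (𝕊 4) 2) × (Fin k → Fin 2 → ℤ)) ≃+ ↥(freeCohomology ℤ P 2)),
      Epi (singularHomology.map ℤ ℤ (⟨ι, hι.isEmbedding.continuous⟩ : C(P, V)) 2) ∧
      (∀ y : singularHomology ℤ ℤ P 2,
        (∀ j, freeKroneckerPairing P 2 (Θ (0, Pi.single j (Pi.single 0 1))) y = 0) →
        singularHomology.map ℤ ℤ (⟨ι, hι.isEmbedding.continuous⟩ : C(P, V)) 2 y = 0) ∧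
      (∀ x y, Q⟦μP⟧ (Θ x) (Θ y) = ∑ j, hyperbolicForm (x.2 j) (y.2 j)) := by
  haveI : SimplyConnectedSpace (𝕊 4) := simplyConnectedSpace_euclideanSphere (n := 4) (by norm_num)
  -- the stabilisation cobordism with its lattice data
  obtain ⟨hPsc, -, -, hdata⟩ := exists_stabilisationCobordism k (𝕊 4) P hP
  haveI := hPsc
  obtain ⟨μS⟩ := isOrientableOver_of_simplyConnectedSpace ℤ (𝕊 4) (n := 4)
  obtain ⟨E, b, Θ, ε, μS', hEsc, hEepi, -, -, -, hP2, -, hP4⟩ := hdata μS μP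
  haveI := hEsc
  -- attach `E` to the closed ball
  let c₀ : NullCobordism 4 (𝕊 4) := NullCobordism.closedBall 4
  obtain ⟨V, i1, i2, i3, i4, i5, ⟨At⟩⟩ := exists_cobordismAttachment_holds 3 c₀.W c₀.boundaryData
    (𝕊 4) P E (Diffeomorph.refl (𝓡 4) (𝕊 4) ∞)
  haveI : CompactSpace V := At.compactSpace
  haveI : ContractibleSpace c₀.W := contractibleSpace_closedBall 5
  haveI : SimplyConnectedSpace V := At.simplyConnectedSpace
  -- `H₂(𝕊⁴) → H₂(𝔻⁵)` is onto (the target vanishes), so `jX_* : H₂(E) → H₂(V)` is onto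
  have hD : IsZero (singularHomology ℤ ℤ c₀.W 2) :=
    isZero_singularHomology_of_contractibleSpace ℤ ℤ two_ne_zero
  haveI : Epi (singularHomology.map ℤ ℤ c₀.boundaryData.inclC (1 + 1)) :=
    ⟨fun g h _ => hD.eq_of_src g h⟩
  have h1S : IsZero (singularHomology ℤ ℤ (𝕊 4) 1) :=
    isZero_singularHomology_one_of_simplyConnectedSpace ℤ ℤ
  have hepiJ : Epi (singularHomology.map ℤ ℤ At.jXC (1 + 1)) := At.epi_map_jX_of_epi ℤ ℤ h1S
  have hfac : (⟨At.jX ∘ E.inr, At.isSmoothEmbedding_jX_comp_inr.isEmbedding.continuous⟩ : C(P, V)) =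
      At.jXC.comp ⟨E.inr, E.continuous_inr⟩ := rfl
  refine ⟨V, i1, i2, i3, i4, i5, ‹_›, ‹_›, At.jX ∘ E.inr, At.isSmoothEmbedding_jX_comp_inr,
    At.range_jX_comp_inr, Θ, ?_, fun y hy => ?_, fun x y => ?_⟩
  · rw [hfac, singularHomology.map_comp]
    haveI := hEepi
    haveI := hepiJ
    apply epi_comp
  · -- `y ⊥ βⱼ` comes from `H₂(𝕊⁴) = 0`
    obtain ⟨w, hw⟩ := hP2 y hy
    have h2S : IsZero (singularHomology ℤ ℤ (𝕊 4) 2) :=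
      isZero_singularHomology_sphere_holds ℤ ℤ (n := 4) (k := 2) (by omega) (by omega)
    haveI := ModuleCat.subsingleton_of_isZero h2S
    rw [Subsingleton.elim w 0, map_zero] at hw
    rw [hfac, singularHomology.map_comp, ModuleCat.comp_apply, hw, map_zero]
  · rw [hP4, freeCohomology_sphereFour_two_eq_zero x.1, map_zero, LinearMap.zero_apply, zero_add]

end Literature.Topology.FourManifolds

end
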